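import Summits.QuantumFields.YangMills.Theorems.UnitScaleTiltProp7LocMinOfChartSliceHess
import Summits.QuantumFields.YangMills.Theorems.UnitScaleTiltProp7HessWOfFibreCoreT3
import Summits.QuantumFields.YangMills.Theorems.UnitScaleTiltProp7UntwistedChartOfBlend
import Literature.MathematicalPhysics.QuantumFieldTheory.Balaban1983to89.T3PrintedRegularOrbits
import HarnessLib

/-!
# Route `UnitScaleTilt`, crux K1 child «MinimiserStabilityRegPr» (stmt-QuantumFields-19200) — E′'s GROWTH SIDE FROM ONE SLICE INEQUALITY PER COMPETITOR (path (α)∕(α′)):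
# E′ ⇐ ∀ competitors ∃ pinned gauge `g` (or just a fibre point `Y` with the same action) {sup chart `sQℓ⁻¹`, `DIV(−i log(YW⁻¹)) ≤ ζ·K + δ₁ℓ⁻²M`}

Cell `ym3-torus` ∕ fleet seat `ym-ust-19200-p1` (gen 14, route-R lead ∕ (n3) namer).  THEOREMS ONLY (0 `def`, 0 `sorry`); `--supports stmt-QuantumFields-19200`, count-neutral.
YM₃ on T³ is a ladder rung (R3), not the Clay problem; nothing here claims the stub, the crux, d = 4 or the mass gap; E′ is NOT closed by this file.

WHY.  After the final door ✓`Prop7LocMinOfChartSliceHess.stub_PV3E_of_chartSliceHess` (JOINT discharged by the (n3) chain) the E′ residue per competitor is {CHART + untwisted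
membership, HESS K-only, crude slice} for ONE representative.  On a pinned-gauge chart (or any fibre point `Y` with the competitor's action) the chart rows are free
(✓`Prop7UntwistedChartOfBlend` §1, (4)-invariance), and the CURVED (116) core ✓`hessW_curl_div_of_mem_fibre_T3` turns ONE slice inequality `DIV ≤ ζK (+ δ₁ℓ⁻²M, δ₁ < 4κ_H)`
into BOTH the K-only HESS row and the crude slice.  Inhabitant of record (α′): `Y := (e^{iD‴}W)^{e^{−ψ}}`, `D‴` the untwisted print representative (✓`Prop7UntwistChartOfTwist`),
`e^{−ψ}` the pinned centre-harmonic (S_H) re-gauging (flat rows ✓`Prop7CentreHarmonicRegaugeSup`, LEMMA H ✓`Prop7CentreHarmonicDivFlat`; curved∕BCH junctions open).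

WHAT IS PROVED (ns `…Theorems.Prop7LocMinOfPinnedChartSlice`): ★★★ `stub_PV3E_of_pinnedChartSlice` (δ₁ = 0), ★★★ `stub_PV3E_of_pinnedChartSliceM` (mass slack δ₁ < 4κ_H),
★★★ `stub_PV3E_of_fibrePointSlice` (gauge-free form).  HONEST SCOPE: bookkeeping over landed theorems; the per-competitor rows are DISPLAYED, not proved.

References: T. Bałaban, CMP 102 (1985) 277–309 [Balaban1985Variational] ((4)–(7) p.278, (14)–(15) p.280, (112) p.294, (116) p.295, (141)–(143), Prop. 7 p.299);
CMP 99 (1985) 389–434 [Balaban1985BackgroundPropagators] ((3.9)–(3.11) p.392); CMP 98 (1985) 17–51 [Balaban1985Averaging] ((11) p.19, (19)–(21) p.21).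
-/

set_option autoImplicit false
noncomputable section

open scoped BigOperators Matrix.Norms.L2Operator Matrix Topology
open Filter

namespace Summit.QuantumFields.YangMills.Theorems.Prop7LocMinOfPinnedChartSlice

open Literature.MathematicalPhysics.QuantumFieldTheory.Balaban1983to89
open Literature.MathematicalPhysics.QuantumFieldTheory.Balaban1983to89.T3ContinuumYM3Torus
open Literature.MathematicalPhysics.QuantumFieldTheory.Balaban1983to89.T3UnitLawDensityEML (ℰp)
open Literature.MathematicalPhysics.QuantumFieldTheory.Balaban1983to89.T3ConstrainedMinimiser
open Literature.MathematicalPhysics.QuantumFieldTheory.Balaban1983to89.T3Thm1Carrier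
open Literature.MathematicalPhysics.QuantumFieldTheory.Balaban1983to89.T3PrintedRegularMinimiser
open Literature.MathematicalPhysics.QuantumFieldTheory.Balaban1983to89.T3RegularMinimiser
open Literature.MathematicalPhysics.QuantumFieldTheory.Balaban1983to89.T3Thm1CarrierNative (IsCritR2)
open Literature.MathematicalPhysics.QuantumFieldTheory.Balaban1983to89.T3SectALandauChart (emb15 CloseAvg pos_of_regPr)
open T4Continuum BlockAveraging AveragingRT ExpMeanLog BlockAveragingEMLLinearised BlockAveragingEMLLinearisedBackground BlockAveragingEMLProp2
open Summit.QuantumFields.YangMills.Theorems.Prop7TPrint (expHermField)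
open Summit.QuantumFields.YangMills.Theorems.Prop7LocMinOfJointRow (isMinOn_regFibrePr_of_linRows_at linRow_of_QRows)
open Summit.QuantumFields.YangMills.Theorems.Prop7FirstVariationExactPairing (abs_lin_le_sum_norm_trueLinIter tower_loop_rows_of_regPr gaugeDir_mem_su2)
open Summit.QuantumFields.YangMills.Theorems.Prop7CurvedLandauRowA (exists_trueLinIter_family)
open Summit.QuantumFields.YangMills.Theorems.Prop7LocMinOfMultiplierRows (I_smul_mem_skewAdjoint trace_I_smul_eq_zero scaled_smallness_mult)
open Summit.QuantumFields.YangMills.Theorems.Prop7TrueLinPureGaugeIter (trueLinIter_sub trueLinIter_pureGauge)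
open Summit.QuantumFields.YangMills.Theorems.Prop7LinGaugeInvariance (lin_sub_gaugeDir_eq)
open Summit.QuantumFields.YangMills.Theorems.Prop7LocMinOfChartSliceHess (stub_PV3E_of_chartSliceHess)
open Summit.QuantumFields.YangMills.Theorems.Prop7HessWOfFibreCoreT3 (hessW_curl_div_of_mem_fibre_T3)
open Summit.QuantumFields.YangMills.Theorems.Prop7UntwistedChartOfBlend (hermLog_isHermitian hermLog_trace norm_hermLog_le expHerm_hermLog)
open Summit.QuantumFields.YangMills.Theorems.Prop7TPrint (expHerm coe_expHerm expHermField_apply)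
open Literature.MathematicalPhysics.QuantumFieldTheory.Balaban1983to89.T3PrintedRegularOrbits (descTransf gaugeAct_mem_regFibrePr_iff_of_trivial)
open MatrixLog (mlog)
open Literature.MathematicalPhysics.QuantumFieldTheory.Balaban1983to89.T3ConstrainedMinimiser (fibre)
open B9Eq39Adjoint (divB)
open B9TorusCalculus (torusT)
open B10Eq27TorusAxialLog (unitsField toUField)
open B15DeterminingSets (embIter)
open B5Eq118OneStroke (iterBlockOf)
open Node00 (iterBlockOf_embIter_eq)

/-! ## ★★★ E′ from the pinned chart and one slice inequality -/

set_option maxHeartbeats 800000 in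
/-- ★★★ **ROW E′ FROM THE PINNED-GAUGE CHART AND ONE SLICE INEQUALITY PER COMPETITOR (path (α)).**  For every `L > 1` constants `e₆ > 0` (`10¹⁴L⁹e₆ ≤ 1`), `s_Q ≥ 0`
(`8s_Q ≤ 1`, `8·10¹¹L⁹s_Q ≤ 1`), `ζ ≥ 0` with `16e₆C₂(L)(1+ζ) ≤ 1` and `15552(2s_Q)² + 216e₆ + 2e₆C₁(L) ≤ (κ_H(L)∕(1+ζ∕4))∕8` (`κ_H(L) = 1∕(128(18+537600L⁴))`,
`C₁(L), C₂(L)` = ✓`jointRow_of_suppliers`' constants written out) such that at every member, radius `0 < e ≤ e₆`, datum `V`, R2-critical `W ∈ (6)(e) ∩ 𝔅_k(V)`, EVERY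
competitor `W′ ∈ (6)(e) ∩ 𝔅_k(V)` has a PINNED gauge `g` (`g↓ = 1`) with `‖(W′^g)_b·W_b⁻¹ − 1‖ ≤ s_Q·ℓ⁻¹` on every bond and, for the Hermitian logarithm
`D = −i·log((W′^g)_b W_b⁻¹)` of that chart, the ONE slice inequality `DIV(D) ≤ ζ·K(D)` ((116) letters).  CONCLUSION = the E′ text verbatim.  Proof: `D` is
Hermitian-traceless with `‖D b‖ ≤ 2s_Qℓ⁻¹` (✓`Prop7UntwistedChartOfBlend` §1), `e^{iD}W = W′^g` (✓`expHerm_hermLog`) is on the fibre ((4)-invariance,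
✓`gaugeAct_mem_regFibrePr_iff_of_trivial`) with the same action; HESS K-only with `κ₀ = κ_H∕(1+ζ∕4)` from ✓`hessW_curl_div_of_mem_fibre_T3` + the slice; then
✓`stub_PV3E_of_chartSliceHess` (`s₀ := 2s_Q`, `δ₁ := 0`).  Suppliers of the hypothesis: ✓`exists_blendedGauge_T3` gives the pinned chart with `s_Q = 1102176e`
(★w1-19200 g11); the slice inequality is the residue (S_H re-gauging: LEMMA (S_H-SUP) + «DIV ≤ ζK on S_H ∩ fibre», ★routeR-w3 ∕ px17).
[cite: Balaban1985Variational, (141)-(143) p.299, Prop. 7 p.299, (4)-(7) p.278, (14)-(15) p.280, (112) p.294, (116) p.295; Balaban1985BackgroundPropagators, (3.9)-(3.11) p.392; Balaban1985Averaging, (19)-(21) p.21] -/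
theorem stub_PV3E_of_pinnedChartSlice
    (hrowsU : ∀ (L : ℕ), 1 < L → ∃ e₆ sQ ζ : ℝ, 0 < e₆ ∧ 100000000000000 * (L : ℝ) ^ 9 * e₆ ≤ 1 ∧ 0 ≤ sQ ∧ 8 * sQ ≤ 1 ∧
      800000000000 * (L : ℝ) ^ 9 * sQ ≤ 1 ∧ 0 ≤ ζ ∧
      16 * e₆ * ((8 * ((3 / 2) * (694800 * (L : ℝ) ^ 5) * (28800 * (L : ℝ) ^ 4) * ((L : ℝ) ^ 2 / ((L : ℝ) ^ 3 - 1)))) * (1 + ζ)) ≤ 1 ∧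
      15552 * (2 * sQ) ^ 2 + 216 * e₆ + 2 * e₆ * (2 * ((3 / 2) * (694800 * (L : ℝ) ^ 5) * (7 * ((L : ℝ) ^ 2 / ((L : ℝ) - 1)) + 600000 * (L : ℝ) ^ 4 * ((L : ℝ) ^ 2 / ((L : ℝ) ^ 3 - 1)))) + 322608 * ((3 / 2) * (694800 * (L : ℝ) ^ 5) * (28800 * (L : ℝ) ^ 4) * ((L : ℝ) ^ 2 / ((L : ℝ) ^ 3 - 1))))
        ≤ ((1 / (128 * (18 + 537600 * (L : ℝ) ^ 4))) / (1 + ζ / 4)) / 8 ∧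
      ∀ (F : T3Family), F.L = L → ∀ (n K : ℕ) (hnK : n < K) (e : ℝ) (V : GaugeField (F.P n) 0 (Matrix.specialUnitaryGroup (Fin 2) ℂ))
        (W : GaugeField (F.P K) 0 (Matrix.specialUnitaryGroup (Fin 2) ℂ)),
        0 < e → e ≤ e₆ → W ∈ regFibrePr F n K hnK.le e V → IsCritR2 F n K hnK.le V W →
        ∀ W' : GaugeField (F.P K) 0 (Matrix.specialUnitaryGroup (Fin 2) ℂ), W' ∈ regFibrePr F n K hnK.le e V →
          ∃ g : GaugeTransf (F.P K) 0 (Matrix.specialUnitaryGroup (Fin 2) ℂ), descTransf F n K hnK.le g = (fun _ => 1) ∧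
            (∀ b : PBond (F.P K) 0, ‖((GaugeField.gaugeAct g W' b * (W b)⁻¹ : Matrix.specialUnitaryGroup (Fin 2) ℂ) : Matrix (Fin 2) (Fin 2) ℂ) - 1‖
              ≤ sQ * ((F.L : ℝ) ^ (K - n))⁻¹) ∧
            ∀ D : PBond (F.P K) 0 → Matrix (Fin 2) (Fin 2) ℂ,
              D = (fun b => (-Complex.I) • mlog ((GaugeField.gaugeAct g W' b * (W b)⁻¹ : Matrix.specialUnitaryGroup (Fin 2) ℂ) : Matrix (Fin 2) (Fin 2) ℂ)) →
              (∑ x : Site (F.P K) 0, ∑ j : Fin 2, ∑ k : Fin 2,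
            ‖(divB (torusT (F.P K) 0) (fun κ z => unitsField (toUField W) ⟨z, κ⟩) (fun κ z => Complex.I • D ⟨z, κ⟩) x) j k‖ ^ 2)
                ≤ ζ * (∑ p : Plaq (F.P K) 0, ‖((Complex.I • D ⟨p.src, p.μ⟩) + ((W ⟨p.src, p.μ⟩ : Matrix (Fin 2) (Fin 2) ℂ) * (Complex.I • D ⟨p.src.shift p.μ, p.ν⟩) * star (W ⟨p.src, p.μ⟩ : Matrix (Fin 2) (Fin 2) ℂ))
            - (((W ⟨p.src, p.μ⟩ * W ⟨p.src.shift p.μ, p.ν⟩ * (W ⟨p.src.shift p.ν, p.μ⟩)⁻¹ : Matrix.specialUnitaryGroup (Fin 2) ℂ) : Matrix (Fin 2) (Fin 2) ℂ) * (Complex.I • D ⟨p.src.shift p.ν, p.μ⟩) * star ((W ⟨p.src, p.μ⟩ * W ⟨p.src.shift p.μ, p.ν⟩ * (W ⟨p.src.shift p.ν, p.μ⟩)⁻¹ : Matrix.specialUnitaryGroup (Fin 2) ℂ) : Matrix (Fin 2) (Fin 2) ℂ))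
            - (((GaugeField.plaqHol W p : Matrix.specialUnitaryGroup (Fin 2) ℂ) : Matrix (Fin 2) (Fin 2) ℂ) * (Complex.I • D ⟨p.src, p.ν⟩) * star ((GaugeField.plaqHol W p : Matrix.specialUnitaryGroup (Fin 2) ℂ) : Matrix (Fin 2) (Fin 2) ℂ)))‖ ^ 2)) :
    ∀ (L : ℕ), 1 < L → ∀ (B₃ : ℝ), 4 < B₃ →
    ∃ e₅ a₁'' : ℝ, 0 < e₅ ∧ 0 < a₁'' ∧ ∀ (i : Idx L) (e ε₁ : ℝ) (V : GaugeField (i.1.1.P i.1.2.1) 0 (Matrix.specialUnitaryGroup (Fin 2) ℂ))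
      (U₀ W : GaugeField (i.1.1.P i.1.2.2) 0 (Matrix.specialUnitaryGroup (Fin 2) ℂ)),
      0 < ε₁ → ε₁ ≤ a₁'' → PlaqSmall ε₁ V → (L : ℝ) ^ 3 * B₃ * ε₁ ≤ e → e ≤ e₅ →
      RegPr i.1.1 i.1.2.1 i.1.2.2 ((L : ℝ) ^ 3 * B₃ * ε₁) U₀ → CloseAvg i.1.1 i.1.2.1 i.1.2.2 i.2.2.le ((L : ℝ) ^ 3 * ε₁) V U₀ →
      W ∈ regFibrePr i.1.1 i.1.2.1 i.1.2.2 i.2.2.le e V → IsCritR2 i.1.1 i.1.2.1 i.1.2.2 i.2.2.le V W →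
        IsMinOn (fun W' : GaugeField (i.1.1.P i.1.2.2) 0 (Matrix.specialUnitaryGroup (Fin 2) ℂ) => wilsonAction4 W')
          (regFibrePr i.1.1 i.1.2.1 i.1.2.2 i.2.2.le e V) W := by
  intro L hL B₃ hB₃
  refine stub_PV3E_of_chartSliceHess ?_ L hL B₃ hB₃
  intro L' hL'
  obtain ⟨e₆, sQ, ζ, he₆, he₆L, hsQ, hsQ8, hsQL, hζ, hC₂e, hsmall, H⟩ := hrowsU L' hL'
  refine ⟨e₆, 2 * sQ, (1 / (128 * (18 + 537600 * (L' : ℝ) ^ 4))) / (1 + ζ / 4), ζ, 0, he₆, he₆L, by positivity, by linarith, by nlinarith, le_rfl, hC₂e, ?_, ?_⟩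
  · -- the smallness window with `δ₁ = 0`
    simpa only [mul_zero, add_zero] using hsmall
  intro F hF n K hnK e V W he hhi hW hWcrit W' hW'
  obtain ⟨g, hg1, hQ, hζrow⟩ := H F hF n K hnK e V W he hhi hW hWcrit W' hW'
  have hFL : (F.L : ℝ) = (L' : ℝ) := by exact_mod_cast hF
  have hL1r : (1 : ℝ) < (L' : ℝ) := by exact_mod_cast hL'
  have hL1 : (1 : ℝ) ≤ (F.L : ℝ) := by rw [hFL]; exact hL1r.le
  have hL0 : (0 : ℝ) < (F.L : ℝ) := by linarith
  set ℓ : ℝ := (F.L : ℝ) ^ (K - n) with hℓ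
  have hℓ1 : (1 : ℝ) ≤ ℓ := one_le_pow₀ hL1
  have hℓ0 : (0 : ℝ) < ℓ := by linarith
  have hℓi1 : ℓ⁻¹ ≤ 1 := inv_le_one_of_one_le₀ hℓ1
  have hℓi0 : (0 : ℝ) ≤ ℓ⁻¹ := by positivity
  -- the chart `Q_b = (W′^g)_b W_b⁻¹`, within `1∕3` of `1`
  set Qc : PBond (F.P K) 0 → Matrix.specialUnitaryGroup (Fin 2) ℂ := fun b => GaugeField.gaugeAct g W' b * (W b)⁻¹ with hQc
  have hthird : ∀ b, ‖(Qc b : Matrix (Fin 2) (Fin 2) ℂ) - 1‖ ≤ 1 / 3 := fun b => by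
    refine (hQ b).trans ?_
    calc sQ * ℓ⁻¹ ≤ sQ * 1 := mul_le_mul_of_nonneg_left hℓi1 hsQ
      _ ≤ 1 / 3 := by linarith
  set D : PBond (F.P K) 0 → Matrix (Fin 2) (Fin 2) ℂ := fun b => (-Complex.I) • mlog (Qc b : Matrix (Fin 2) (Fin 2) ℂ) with hD
  have hDh : ∀ b : PBond (F.P K) 0, (D b).IsHermitian ∧ Matrix.trace (D b) = 0 := fun b => by
    have hQb := Matrix.mem_specialUnitaryGroup_iff.1 (Qc b).2
    exact ⟨hermLog_isHermitian hQb.1 (hthird b), hermLog_trace hQb.2 (hthird b)⟩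
  have hDs : ∀ b : PBond (F.P K) 0, ‖D b‖ ≤ 2 * sQ * ℓ⁻¹ := fun b => by
    calc ‖D b‖ ≤ 2 * ‖(Qc b : Matrix (Fin 2) (Fin 2) ℂ) - 1‖ := norm_hermLog_le ((hthird b).trans (by norm_num))
      _ ≤ 2 * (sQ * ℓ⁻¹) := by linarith [hQ b]
      _ = 2 * sQ * ℓ⁻¹ := by ring
  -- `e^{iD}·W = W′^g`
  have hcfg : emb15 W (expHermField D) = GaugeField.gaugeAct g W' := by
    funext b
    show expHerm ((-Complex.I) • mlog (Qc b : Matrix (Fin 2) (Fin 2) ℂ)) * W b = GaugeField.gaugeAct g W' b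
    rw [expHerm_hermLog (Qc b) (hthird b), hQc, inv_mul_cancel_right]
  have hA : wilsonAction4 W' = wilsonAction4 (emb15 W (expHermField D)) := by
    rw [hcfg]; exact (T4WilsonGaugeFlatDirection.wilsonAction_gaugeAct 1 g W').symm
  have he0 : (0 : ℝ) < e := he
  have hmemPr : GaugeField.gaugeAct g W' ∈ regFibrePr F n K hnK.le e V :=
    (gaugeAct_mem_regFibrePr_iff_of_trivial F hnK.le he0.le hg1 W' V).mpr hW'
  have hfibD : emb15 W (expHermField D) ∈ fibre F ℰp n K hnK.le V := by
    rw [hcfg]; exact ((mem_regFibrePr_iff F).mp hmemPr).1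
  -- HESS K-only from the (116) core and the slice inequality
  have heL : 100000000000000 * (F.L : ℝ) ^ 9 * e ≤ 1 := by
    rw [hFL]
    have : 100000000000000 * (L' : ℝ) ^ 9 * e ≤ 100000000000000 * (L' : ℝ) ^ 9 * e₆ := mul_le_mul_of_nonneg_left hhi (by positivity)
    exact this.trans he₆L
  have hs0 : (0 : ℝ) ≤ 2 * sQ * ℓ⁻¹ := by positivity
  have hsL : 400000000000 * (F.L : ℝ) ^ 9 * (ℓ * (2 * sQ * ℓ⁻¹)) ≤ 1 := by
    rw [show ℓ * (2 * sQ * ℓ⁻¹) = 2 * sQ by field_simp, hFL]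
    linarith
  have h116 := hessW_curl_div_of_mem_fibre_T3 F hnK.le V hW heL D hDh hs0 hDs hsL hfibD
  have hsl := hζrow D rfl
  set Kc : ℝ := ∑ p : Plaq (F.P K) 0, ‖((Complex.I • D ⟨p.src, p.μ⟩) + ((W ⟨p.src, p.μ⟩ : Matrix (Fin 2) (Fin 2) ℂ) * (Complex.I • D ⟨p.src.shift p.μ, p.ν⟩) * star (W ⟨p.src, p.μ⟩ : Matrix (Fin 2) (Fin 2) ℂ))
            - (((W ⟨p.src, p.μ⟩ * W ⟨p.src.shift p.μ, p.ν⟩ * (W ⟨p.src.shift p.ν, p.μ⟩)⁻¹ : Matrix.specialUnitaryGroup (Fin 2) ℂ) : Matrix (Fin 2) (Fin 2) ℂ) * (Complex.I • D ⟨p.src.shift p.ν, p.μ⟩) * star ((W ⟨p.src, p.μ⟩ * W ⟨p.src.shift p.μ, p.ν⟩ * (W ⟨p.src.shift p.ν, p.μ⟩)⁻¹ : Matrix.specialUnitaryGroup (Fin 2) ℂ) : Matrix (Fin 2) (Fin 2) ℂ))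
            - (((GaugeField.plaqHol W p : Matrix.specialUnitaryGroup (Fin 2) ℂ) : Matrix (Fin 2) (Fin 2) ℂ) * (Complex.I • D ⟨p.src, p.ν⟩) * star ((GaugeField.plaqHol W p : Matrix.specialUnitaryGroup (Fin 2) ℂ) : Matrix (Fin 2) (Fin 2) ℂ)))‖ ^ 2 with hKc
  set Dv : ℝ := ∑ x : Site (F.P K) 0, ∑ j : Fin 2, ∑ k : Fin 2,
            ‖(divB (torusT (F.P K) 0) (fun κ z => unitsField (toUField W) ⟨z, κ⟩) (fun κ z => Complex.I • D ⟨z, κ⟩) x) j k‖ ^ 2 with hDv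
  set Mm : ℝ := ∑ b : PBond (F.P K) 0, ‖D b‖ ^ 2 with hMm
  have hKc0 : 0 ≤ Kc := Finset.sum_nonneg fun _ _ => sq_nonneg _
  have hMm0 : 0 ≤ Mm := Finset.sum_nonneg fun _ _ => sq_nonneg _
  have hκH0 : (0 : ℝ) < 1 / (128 * (18 + 537600 * (F.L : ℝ) ^ 4)) := by positivity
  have hζ4 : (0 : ℝ) < 1 + ζ / 4 := by linarith
  have hHESS : (1 / (128 * (18 + 537600 * (L' : ℝ) ^ 4))) / (1 + ζ / 4) * (ℓ ^ 2)⁻¹ * Mm ≤ Kc := by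
    rw [← hFL]
    -- `κ_H ℓ⁻² M ≤ Kc + ¼Dv ≤ (1 + ζ∕4) Kc`
    have h1 : (1 / (128 * (18 + 537600 * (F.L : ℝ) ^ 4))) * (ℓ ^ 2)⁻¹ * Mm ≤ (1 + ζ / 4) * Kc := by
      have := h116
      nlinarith [hsl, this]
    rw [div_mul_eq_mul_div, div_mul_eq_mul_div, div_le_iff₀ hζ4]
    linarith [h1]
  have hSLICE : Dv ≤ ζ * Kc + 0 * (ℓ ^ 2)⁻¹ * Mm := by rw [zero_mul, zero_mul, add_zero]; exact hsl
  exact ⟨D, hDh, hDs, hA, hfibD, hHESS, hSLICE⟩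


set_option maxHeartbeats 800000 in
/-- ★★★ **THE SAME WITH A SECOND-ORDER MASS SLACK** `DIV(D) ≤ ζK(D) + δ₁ℓ⁻²Σ‖D‖²`, `0 ≤ δ₁ < 4κ_H(L)`, window `… + 2e₆(C₁ + C₂δ₁) ≤ ((κ_H − δ₁∕4)∕(1+ζ∕4))∕8`
(for NONLINEAR re-gaugings: S_H holds to first order, BCH remainders are `O(s_Q²)` — a `δ₁ ≍ C·s_Q²` is admissible; an O(1)·ℓ⁻²M booking of the whole divergence is not).
[cite: Balaban1985Variational, (141)-(143) p.299, (116) p.295, (4)-(7) p.278; Balaban1985BackgroundPropagators, (3.9)-(3.11) p.392; Balaban1985Averaging, (19)-(21) p.21] -/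
theorem stub_PV3E_of_pinnedChartSliceM
    (hrowsU : ∀ (L : ℕ), 1 < L → ∃ e₆ sQ ζ δ₁ : ℝ, 0 < e₆ ∧ 100000000000000 * (L : ℝ) ^ 9 * e₆ ≤ 1 ∧ 0 ≤ sQ ∧ 8 * sQ ≤ 1 ∧
      800000000000 * (L : ℝ) ^ 9 * sQ ≤ 1 ∧ 0 ≤ ζ ∧ 0 ≤ δ₁ ∧ δ₁ < 4 * (1 / (128 * (18 + 537600 * (L : ℝ) ^ 4))) ∧
      16 * e₆ * ((8 * ((3 / 2) * (694800 * (L : ℝ) ^ 5) * (28800 * (L : ℝ) ^ 4) * ((L : ℝ) ^ 2 / ((L : ℝ) ^ 3 - 1)))) * (1 + ζ)) ≤ 1 ∧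
      15552 * (2 * sQ) ^ 2 + 216 * e₆ + 2 * e₆ * ((2 * ((3 / 2) * (694800 * (L : ℝ) ^ 5) * (7 * ((L : ℝ) ^ 2 / ((L : ℝ) - 1)) + 600000 * (L : ℝ) ^ 4 * ((L : ℝ) ^ 2 / ((L : ℝ) ^ 3 - 1)))) + 322608 * ((3 / 2) * (694800 * (L : ℝ) ^ 5) * (28800 * (L : ℝ) ^ 4) * ((L : ℝ) ^ 2 / ((L : ℝ) ^ 3 - 1))))
        + (8 * ((3 / 2) * (694800 * (L : ℝ) ^ 5) * (28800 * (L : ℝ) ^ 4) * ((L : ℝ) ^ 2 / ((L : ℝ) ^ 3 - 1)))) * δ₁)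
        ≤ (((1 / (128 * (18 + 537600 * (L : ℝ) ^ 4))) - δ₁ / 4) / (1 + ζ / 4)) / 8 ∧
      ∀ (F : T3Family), F.L = L → ∀ (n K : ℕ) (hnK : n < K) (e : ℝ) (V : GaugeField (F.P n) 0 (Matrix.specialUnitaryGroup (Fin 2) ℂ))
        (W : GaugeField (F.P K) 0 (Matrix.specialUnitaryGroup (Fin 2) ℂ)),
        0 < e → e ≤ e₆ → W ∈ regFibrePr F n K hnK.le e V → IsCritR2 F n K hnK.le V W →
        ∀ W' : GaugeField (F.P K) 0 (Matrix.specialUnitaryGroup (Fin 2) ℂ), W' ∈ regFibrePr F n K hnK.le e V →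
          ∃ g : GaugeTransf (F.P K) 0 (Matrix.specialUnitaryGroup (Fin 2) ℂ), descTransf F n K hnK.le g = (fun _ => 1) ∧
            (∀ b : PBond (F.P K) 0, ‖((GaugeField.gaugeAct g W' b * (W b)⁻¹ : Matrix.specialUnitaryGroup (Fin 2) ℂ) : Matrix (Fin 2) (Fin 2) ℂ) - 1‖
              ≤ sQ * ((F.L : ℝ) ^ (K - n))⁻¹) ∧
            ∀ D : PBond (F.P K) 0 → Matrix (Fin 2) (Fin 2) ℂ,
              D = (fun b => (-Complex.I) • mlog ((GaugeField.gaugeAct g W' b * (W b)⁻¹ : Matrix.specialUnitaryGroup (Fin 2) ℂ) : Matrix (Fin 2) (Fin 2) ℂ)) →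
              (∑ x : Site (F.P K) 0, ∑ j : Fin 2, ∑ k : Fin 2,
            ‖(divB (torusT (F.P K) 0) (fun κ z => unitsField (toUField W) ⟨z, κ⟩) (fun κ z => Complex.I • D ⟨z, κ⟩) x) j k‖ ^ 2)
                ≤ ζ * (∑ p : Plaq (F.P K) 0, ‖((Complex.I • D ⟨p.src, p.μ⟩) + ((W ⟨p.src, p.μ⟩ : Matrix (Fin 2) (Fin 2) ℂ) * (Complex.I • D ⟨p.src.shift p.μ, p.ν⟩) * star (W ⟨p.src, p.μ⟩ : Matrix (Fin 2) (Fin 2) ℂ))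
            - (((W ⟨p.src, p.μ⟩ * W ⟨p.src.shift p.μ, p.ν⟩ * (W ⟨p.src.shift p.ν, p.μ⟩)⁻¹ : Matrix.specialUnitaryGroup (Fin 2) ℂ) : Matrix (Fin 2) (Fin 2) ℂ) * (Complex.I • D ⟨p.src.shift p.ν, p.μ⟩) * star ((W ⟨p.src, p.μ⟩ * W ⟨p.src.shift p.μ, p.ν⟩ * (W ⟨p.src.shift p.ν, p.μ⟩)⁻¹ : Matrix.specialUnitaryGroup (Fin 2) ℂ) : Matrix (Fin 2) (Fin 2) ℂ))
            - (((GaugeField.plaqHol W p : Matrix.specialUnitaryGroup (Fin 2) ℂ) : Matrix (Fin 2) (Fin 2) ℂ) * (Complex.I • D ⟨p.src, p.ν⟩) * star ((GaugeField.plaqHol W p : Matrix.specialUnitaryGroup (Fin 2) ℂ) : Matrix (Fin 2) (Fin 2) ℂ)))‖ ^ 2)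
                  + δ₁ * (((F.L : ℝ) ^ (K - n)) ^ 2)⁻¹ * ∑ b : PBond (F.P K) 0, ‖D b‖ ^ 2) :
    ∀ (L : ℕ), 1 < L → ∀ (B₃ : ℝ), 4 < B₃ →
    ∃ e₅ a₁'' : ℝ, 0 < e₅ ∧ 0 < a₁'' ∧ ∀ (i : Idx L) (e ε₁ : ℝ) (V : GaugeField (i.1.1.P i.1.2.1) 0 (Matrix.specialUnitaryGroup (Fin 2) ℂ))
      (U₀ W : GaugeField (i.1.1.P i.1.2.2) 0 (Matrix.specialUnitaryGroup (Fin 2) ℂ)),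
      0 < ε₁ → ε₁ ≤ a₁'' → PlaqSmall ε₁ V → (L : ℝ) ^ 3 * B₃ * ε₁ ≤ e → e ≤ e₅ →
      RegPr i.1.1 i.1.2.1 i.1.2.2 ((L : ℝ) ^ 3 * B₃ * ε₁) U₀ → CloseAvg i.1.1 i.1.2.1 i.1.2.2 i.2.2.le ((L : ℝ) ^ 3 * ε₁) V U₀ →
      W ∈ regFibrePr i.1.1 i.1.2.1 i.1.2.2 i.2.2.le e V → IsCritR2 i.1.1 i.1.2.1 i.1.2.2 i.2.2.le V W →
        IsMinOn (fun W' : GaugeField (i.1.1.P i.1.2.2) 0 (Matrix.specialUnitaryGroup (Fin 2) ℂ) => wilsonAction4 W')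
          (regFibrePr i.1.1 i.1.2.1 i.1.2.2 i.2.2.le e V) W := by
  intro L hL B₃ hB₃
  refine stub_PV3E_of_chartSliceHess ?_ L hL B₃ hB₃
  intro L' hL'
  obtain ⟨e₆, sQ, ζ, δ₁, he₆, he₆L, hsQ, hsQ8, hsQL, hζ, hδ₁, hδκ, hC₂e, hsmall, H⟩ := hrowsU L' hL'
  refine ⟨e₆, 2 * sQ, ((1 / (128 * (18 + 537600 * (L' : ℝ) ^ 4))) - δ₁ / 4) / (1 + ζ / 4), ζ, δ₁, he₆, he₆L, by positivity, by linarith, by nlinarith, hδ₁, hC₂e, hsmall, ?_⟩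
  intro F hF n K hnK e V W he hhi hW hWcrit W' hW'
  obtain ⟨g, hg1, hQ, hζrow⟩ := H F hF n K hnK e V W he hhi hW hWcrit W' hW'
  have hFL : (F.L : ℝ) = (L' : ℝ) := by exact_mod_cast hF
  have hL1r : (1 : ℝ) < (L' : ℝ) := by exact_mod_cast hL'
  have hL1 : (1 : ℝ) ≤ (F.L : ℝ) := by rw [hFL]; exact hL1r.le
  have hL0 : (0 : ℝ) < (F.L : ℝ) := by linarith
  set ℓ : ℝ := (F.L : ℝ) ^ (K - n) with hℓ
  have hℓ1 : (1 : ℝ) ≤ ℓ := one_le_pow₀ hL1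
  have hℓ0 : (0 : ℝ) < ℓ := by linarith
  have hℓi1 : ℓ⁻¹ ≤ 1 := inv_le_one_of_one_le₀ hℓ1
  have hℓi0 : (0 : ℝ) ≤ ℓ⁻¹ := by positivity
  -- the chart `Q_b = (W′^g)_b W_b⁻¹`, within `1∕3` of `1`
  set Qc : PBond (F.P K) 0 → Matrix.specialUnitaryGroup (Fin 2) ℂ := fun b => GaugeField.gaugeAct g W' b * (W b)⁻¹ with hQc
  have hthird : ∀ b, ‖(Qc b : Matrix (Fin 2) (Fin 2) ℂ) - 1‖ ≤ 1 / 3 := fun b => by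
    refine (hQ b).trans ?_
    calc sQ * ℓ⁻¹ ≤ sQ * 1 := mul_le_mul_of_nonneg_left hℓi1 hsQ
      _ ≤ 1 / 3 := by linarith
  set D : PBond (F.P K) 0 → Matrix (Fin 2) (Fin 2) ℂ := fun b => (-Complex.I) • mlog (Qc b : Matrix (Fin 2) (Fin 2) ℂ) with hD
  have hDh : ∀ b : PBond (F.P K) 0, (D b).IsHermitian ∧ Matrix.trace (D b) = 0 := fun b => by
    have hQb := Matrix.mem_specialUnitaryGroup_iff.1 (Qc b).2
    exact ⟨hermLog_isHermitian hQb.1 (hthird b), hermLog_trace hQb.2 (hthird b)⟩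
  have hDs : ∀ b : PBond (F.P K) 0, ‖D b‖ ≤ 2 * sQ * ℓ⁻¹ := fun b => by
    calc ‖D b‖ ≤ 2 * ‖(Qc b : Matrix (Fin 2) (Fin 2) ℂ) - 1‖ := norm_hermLog_le ((hthird b).trans (by norm_num))
      _ ≤ 2 * (sQ * ℓ⁻¹) := by linarith [hQ b]
      _ = 2 * sQ * ℓ⁻¹ := by ring
  -- `e^{iD}·W = W′^g`
  have hcfg : emb15 W (expHermField D) = GaugeField.gaugeAct g W' := by
    funext b
    show expHerm ((-Complex.I) • mlog (Qc b : Matrix (Fin 2) (Fin 2) ℂ)) * W b = GaugeField.gaugeAct g W' b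
    rw [expHerm_hermLog (Qc b) (hthird b), hQc, inv_mul_cancel_right]
  have hA : wilsonAction4 W' = wilsonAction4 (emb15 W (expHermField D)) := by
    rw [hcfg]; exact (T4WilsonGaugeFlatDirection.wilsonAction_gaugeAct 1 g W').symm
  have he0 : (0 : ℝ) < e := he
  have hmemPr : GaugeField.gaugeAct g W' ∈ regFibrePr F n K hnK.le e V :=
    (gaugeAct_mem_regFibrePr_iff_of_trivial F hnK.le he0.le hg1 W' V).mpr hW'
  have hfibD : emb15 W (expHermField D) ∈ fibre F ℰp n K hnK.le V := by
    rw [hcfg]; exact ((mem_regFibrePr_iff F).mp hmemPr).1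
  -- HESS K-only from the (116) core and the slice inequality
  have heL : 100000000000000 * (F.L : ℝ) ^ 9 * e ≤ 1 := by
    rw [hFL]
    have : 100000000000000 * (L' : ℝ) ^ 9 * e ≤ 100000000000000 * (L' : ℝ) ^ 9 * e₆ := mul_le_mul_of_nonneg_left hhi (by positivity)
    exact this.trans he₆L
  have hs0 : (0 : ℝ) ≤ 2 * sQ * ℓ⁻¹ := by positivity
  have hsL : 400000000000 * (F.L : ℝ) ^ 9 * (ℓ * (2 * sQ * ℓ⁻¹)) ≤ 1 := by
    rw [show ℓ * (2 * sQ * ℓ⁻¹) = 2 * sQ by field_simp, hFL]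
    linarith
  have h116 := hessW_curl_div_of_mem_fibre_T3 F hnK.le V hW heL D hDh hs0 hDs hsL hfibD
  have hsl := hζrow D rfl
  set Kc : ℝ := ∑ p : Plaq (F.P K) 0, ‖((Complex.I • D ⟨p.src, p.μ⟩) + ((W ⟨p.src, p.μ⟩ : Matrix (Fin 2) (Fin 2) ℂ) * (Complex.I • D ⟨p.src.shift p.μ, p.ν⟩) * star (W ⟨p.src, p.μ⟩ : Matrix (Fin 2) (Fin 2) ℂ))
            - (((W ⟨p.src, p.μ⟩ * W ⟨p.src.shift p.μ, p.ν⟩ * (W ⟨p.src.shift p.ν, p.μ⟩)⁻¹ : Matrix.specialUnitaryGroup (Fin 2) ℂ) : Matrix (Fin 2) (Fin 2) ℂ) * (Complex.I • D ⟨p.src.shift p.ν, p.μ⟩) * star ((W ⟨p.src, p.μ⟩ * W ⟨p.src.shift p.μ, p.ν⟩ * (W ⟨p.src.shift p.ν, p.μ⟩)⁻¹ : Matrix.specialUnitaryGroup (Fin 2) ℂ) : Matrix (Fin 2) (Fin 2) ℂ))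
            - (((GaugeField.plaqHol W p : Matrix.specialUnitaryGroup (Fin 2) ℂ) : Matrix (Fin 2) (Fin 2) ℂ) * (Complex.I • D ⟨p.src, p.ν⟩) * star ((GaugeField.plaqHol W p : Matrix.specialUnitaryGroup (Fin 2) ℂ) : Matrix (Fin 2) (Fin 2) ℂ)))‖ ^ 2 with hKc
  set Dv : ℝ := ∑ x : Site (F.P K) 0, ∑ j : Fin 2, ∑ k : Fin 2,
            ‖(divB (torusT (F.P K) 0) (fun κ z => unitsField (toUField W) ⟨z, κ⟩) (fun κ z => Complex.I • D ⟨z, κ⟩) x) j k‖ ^ 2 with hDv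
  set Mm : ℝ := ∑ b : PBond (F.P K) 0, ‖D b‖ ^ 2 with hMm
  have hKc0 : 0 ≤ Kc := Finset.sum_nonneg fun _ _ => sq_nonneg _
  have hMm0 : 0 ≤ Mm := Finset.sum_nonneg fun _ _ => sq_nonneg _
  have hκH0 : (0 : ℝ) < 1 / (128 * (18 + 537600 * (F.L : ℝ) ^ 4)) := by positivity
  have hζ4 : (0 : ℝ) < 1 + ζ / 4 := by linarith
  have hHESS : ((1 / (128 * (18 + 537600 * (L' : ℝ) ^ 4))) - δ₁ / 4) / (1 + ζ / 4) * (ℓ ^ 2)⁻¹ * Mm ≤ Kc := by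
    rw [← hFL]
    -- `κ_H ℓ⁻² M ≤ Kc + ¼Dv ≤ (1 + ζ∕4) Kc + ¼δ₁ℓ⁻²M`
    have h1 : ((1 / (128 * (18 + 537600 * (F.L : ℝ) ^ 4))) - δ₁ / 4) * (ℓ ^ 2)⁻¹ * Mm ≤ (1 + ζ / 4) * Kc := by
      have := h116
      nlinarith [hsl, this]
    rw [div_mul_eq_mul_div, div_mul_eq_mul_div, div_le_iff₀ hζ4]
    linarith [h1]
  exact ⟨D, hDh, hDs, hA, hfibD, hHESS, hsl⟩


set_option maxHeartbeats 800000 in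
/-- ★★★ **GAUGE-FREE FORM: E′ FROM ONE FIBRE POINT PER COMPETITOR** — any `Y ∈ (6)(e) ∩ 𝔅_k(V)` with `A(Y) = A(W′)`, sup chart `‖Y_bW_b⁻¹ − 1‖ ≤ s_Qℓ⁻¹` and the
slice inequality for `D = −i·log(Y_bW_b⁻¹)` (constants∕windows as in `stub_PV3E_of_pinnedChartSliceM`); the (α′) knit takes `Y := (e^{iD‴}W)^{e^{−ψ}}`.
[cite: Balaban1985Variational, (141)-(143) p.299, (116) p.295, (4)-(7) p.278; Balaban1985BackgroundPropagators, (3.9)-(3.11) p.392; Balaban1985Averaging, (19)-(21) p.21] -/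
theorem stub_PV3E_of_fibrePointSlice
    (hrowsU : ∀ (L : ℕ), 1 < L → ∃ e₆ sQ ζ δ₁ : ℝ, 0 < e₆ ∧ 100000000000000 * (L : ℝ) ^ 9 * e₆ ≤ 1 ∧ 0 ≤ sQ ∧ 8 * sQ ≤ 1 ∧
      800000000000 * (L : ℝ) ^ 9 * sQ ≤ 1 ∧ 0 ≤ ζ ∧ 0 ≤ δ₁ ∧ δ₁ < 4 * (1 / (128 * (18 + 537600 * (L : ℝ) ^ 4))) ∧
      16 * e₆ * ((8 * ((3 / 2) * (694800 * (L : ℝ) ^ 5) * (28800 * (L : ℝ) ^ 4) * ((L : ℝ) ^ 2 / ((L : ℝ) ^ 3 - 1)))) * (1 + ζ)) ≤ 1 ∧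
      15552 * (2 * sQ) ^ 2 + 216 * e₆ + 2 * e₆ * ((2 * ((3 / 2) * (694800 * (L : ℝ) ^ 5) * (7 * ((L : ℝ) ^ 2 / ((L : ℝ) - 1)) + 600000 * (L : ℝ) ^ 4 * ((L : ℝ) ^ 2 / ((L : ℝ) ^ 3 - 1)))) + 322608 * ((3 / 2) * (694800 * (L : ℝ) ^ 5) * (28800 * (L : ℝ) ^ 4) * ((L : ℝ) ^ 2 / ((L : ℝ) ^ 3 - 1))))
        + (8 * ((3 / 2) * (694800 * (L : ℝ) ^ 5) * (28800 * (L : ℝ) ^ 4) * ((L : ℝ) ^ 2 / ((L : ℝ) ^ 3 - 1)))) * δ₁)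
        ≤ (((1 / (128 * (18 + 537600 * (L : ℝ) ^ 4))) - δ₁ / 4) / (1 + ζ / 4)) / 8 ∧
      ∀ (F : T3Family), F.L = L → ∀ (n K : ℕ) (hnK : n < K) (e : ℝ) (V : GaugeField (F.P n) 0 (Matrix.specialUnitaryGroup (Fin 2) ℂ))
        (W : GaugeField (F.P K) 0 (Matrix.specialUnitaryGroup (Fin 2) ℂ)),
        0 < e → e ≤ e₆ → W ∈ regFibrePr F n K hnK.le e V → IsCritR2 F n K hnK.le V W →
        ∀ W' : GaugeField (F.P K) 0 (Matrix.specialUnitaryGroup (Fin 2) ℂ), W' ∈ regFibrePr F n K hnK.le e V →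
          ∃ Y : GaugeField (F.P K) 0 (Matrix.specialUnitaryGroup (Fin 2) ℂ), Y ∈ regFibrePr F n K hnK.le e V ∧ wilsonAction4 W' = wilsonAction4 Y ∧
            (∀ b : PBond (F.P K) 0, ‖((Y b * (W b)⁻¹ : Matrix.specialUnitaryGroup (Fin 2) ℂ) : Matrix (Fin 2) (Fin 2) ℂ) - 1‖
              ≤ sQ * ((F.L : ℝ) ^ (K - n))⁻¹) ∧
            ∀ D : PBond (F.P K) 0 → Matrix (Fin 2) (Fin 2) ℂ,
              D = (fun b => (-Complex.I) • mlog ((Y b * (W b)⁻¹ : Matrix.specialUnitaryGroup (Fin 2) ℂ) : Matrix (Fin 2) (Fin 2) ℂ)) →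
              (∑ x : Site (F.P K) 0, ∑ j : Fin 2, ∑ k : Fin 2,
            ‖(divB (torusT (F.P K) 0) (fun κ z => unitsField (toUField W) ⟨z, κ⟩) (fun κ z => Complex.I • D ⟨z, κ⟩) x) j k‖ ^ 2)
                ≤ ζ * (∑ p : Plaq (F.P K) 0, ‖((Complex.I • D ⟨p.src, p.μ⟩) + ((W ⟨p.src, p.μ⟩ : Matrix (Fin 2) (Fin 2) ℂ) * (Complex.I • D ⟨p.src.shift p.μ, p.ν⟩) * star (W ⟨p.src, p.μ⟩ : Matrix (Fin 2) (Fin 2) ℂ))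
            - (((W ⟨p.src, p.μ⟩ * W ⟨p.src.shift p.μ, p.ν⟩ * (W ⟨p.src.shift p.ν, p.μ⟩)⁻¹ : Matrix.specialUnitaryGroup (Fin 2) ℂ) : Matrix (Fin 2) (Fin 2) ℂ) * (Complex.I • D ⟨p.src.shift p.ν, p.μ⟩) * star ((W ⟨p.src, p.μ⟩ * W ⟨p.src.shift p.μ, p.ν⟩ * (W ⟨p.src.shift p.ν, p.μ⟩)⁻¹ : Matrix.specialUnitaryGroup (Fin 2) ℂ) : Matrix (Fin 2) (Fin 2) ℂ))
            - (((GaugeField.plaqHol W p : Matrix.specialUnitaryGroup (Fin 2) ℂ) : Matrix (Fin 2) (Fin 2) ℂ) * (Complex.I • D ⟨p.src, p.ν⟩) * star ((GaugeField.plaqHol W p : Matrix.specialUnitaryGroup (Fin 2) ℂ) : Matrix (Fin 2) (Fin 2) ℂ)))‖ ^ 2)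
                  + δ₁ * (((F.L : ℝ) ^ (K - n)) ^ 2)⁻¹ * ∑ b : PBond (F.P K) 0, ‖D b‖ ^ 2) :
    ∀ (L : ℕ), 1 < L → ∀ (B₃ : ℝ), 4 < B₃ →
    ∃ e₅ a₁'' : ℝ, 0 < e₅ ∧ 0 < a₁'' ∧ ∀ (i : Idx L) (e ε₁ : ℝ) (V : GaugeField (i.1.1.P i.1.2.1) 0 (Matrix.specialUnitaryGroup (Fin 2) ℂ))
      (U₀ W : GaugeField (i.1.1.P i.1.2.2) 0 (Matrix.specialUnitaryGroup (Fin 2) ℂ)),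
      0 < ε₁ → ε₁ ≤ a₁'' → PlaqSmall ε₁ V → (L : ℝ) ^ 3 * B₃ * ε₁ ≤ e → e ≤ e₅ →
      RegPr i.1.1 i.1.2.1 i.1.2.2 ((L : ℝ) ^ 3 * B₃ * ε₁) U₀ → CloseAvg i.1.1 i.1.2.1 i.1.2.2 i.2.2.le ((L : ℝ) ^ 3 * ε₁) V U₀ →
      W ∈ regFibrePr i.1.1 i.1.2.1 i.1.2.2 i.2.2.le e V → IsCritR2 i.1.1 i.1.2.1 i.1.2.2 i.2.2.le V W →
        IsMinOn (fun W' : GaugeField (i.1.1.P i.1.2.2) 0 (Matrix.specialUnitaryGroup (Fin 2) ℂ) => wilsonAction4 W')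
          (regFibrePr i.1.1 i.1.2.1 i.1.2.2 i.2.2.le e V) W := by
  intro L hL B₃ hB₃
  refine stub_PV3E_of_chartSliceHess ?_ L hL B₃ hB₃
  intro L' hL'
  obtain ⟨e₆, sQ, ζ, δ₁, he₆, he₆L, hsQ, hsQ8, hsQL, hζ, hδ₁, hδκ, hC₂e, hsmall, H⟩ := hrowsU L' hL'
  refine ⟨e₆, 2 * sQ, ((1 / (128 * (18 + 537600 * (L' : ℝ) ^ 4))) - δ₁ / 4) / (1 + ζ / 4), ζ, δ₁, he₆, he₆L, by positivity, by linarith, by nlinarith, hδ₁, hC₂e, hsmall, ?_⟩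
  intro F hF n K hnK e V W he hhi hW hWcrit W' hW'
  obtain ⟨Y, hYmem, hAY, hQ, hζrow⟩ := H F hF n K hnK e V W he hhi hW hWcrit W' hW'
  have hFL : (F.L : ℝ) = (L' : ℝ) := by exact_mod_cast hF
  have hL1r : (1 : ℝ) < (L' : ℝ) := by exact_mod_cast hL'
  have hL1 : (1 : ℝ) ≤ (F.L : ℝ) := by rw [hFL]; exact hL1r.le
  have hL0 : (0 : ℝ) < (F.L : ℝ) := by linarith
  set ℓ : ℝ := (F.L : ℝ) ^ (K - n) with hℓ
  have hℓ1 : (1 : ℝ) ≤ ℓ := one_le_pow₀ hL1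
  have hℓ0 : (0 : ℝ) < ℓ := by linarith
  have hℓi1 : ℓ⁻¹ ≤ 1 := inv_le_one_of_one_le₀ hℓ1
  have hℓi0 : (0 : ℝ) ≤ ℓ⁻¹ := by positivity
  -- the chart `Q_b = (W′^g)_b W_b⁻¹`, within `1∕3` of `1`
  set Qc : PBond (F.P K) 0 → Matrix.specialUnitaryGroup (Fin 2) ℂ := fun b => Y b * (W b)⁻¹ with hQc
  have hthird : ∀ b, ‖(Qc b : Matrix (Fin 2) (Fin 2) ℂ) - 1‖ ≤ 1 / 3 := fun b => by
    refine (hQ b).trans ?_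
    calc sQ * ℓ⁻¹ ≤ sQ * 1 := mul_le_mul_of_nonneg_left hℓi1 hsQ
      _ ≤ 1 / 3 := by linarith
  set D : PBond (F.P K) 0 → Matrix (Fin 2) (Fin 2) ℂ := fun b => (-Complex.I) • mlog (Qc b : Matrix (Fin 2) (Fin 2) ℂ) with hD
  have hDh : ∀ b : PBond (F.P K) 0, (D b).IsHermitian ∧ Matrix.trace (D b) = 0 := fun b => by
    have hQb := Matrix.mem_specialUnitaryGroup_iff.1 (Qc b).2
    exact ⟨hermLog_isHermitian hQb.1 (hthird b), hermLog_trace hQb.2 (hthird b)⟩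
  have hDs : ∀ b : PBond (F.P K) 0, ‖D b‖ ≤ 2 * sQ * ℓ⁻¹ := fun b => by
    calc ‖D b‖ ≤ 2 * ‖(Qc b : Matrix (Fin 2) (Fin 2) ℂ) - 1‖ := norm_hermLog_le ((hthird b).trans (by norm_num))
      _ ≤ 2 * (sQ * ℓ⁻¹) := by linarith [hQ b]
      _ = 2 * sQ * ℓ⁻¹ := by ring
  -- `e^{iD}·W = Y`
  have hcfg : emb15 W (expHermField D) = Y := by
    funext b
    show expHerm ((-Complex.I) • mlog (Qc b : Matrix (Fin 2) (Fin 2) ℂ)) * W b = Y b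
    rw [expHerm_hermLog (Qc b) (hthird b), hQc, inv_mul_cancel_right]
  have hA : wilsonAction4 W' = wilsonAction4 (emb15 W (expHermField D)) := by rw [hcfg]; exact hAY
  have hfibD : emb15 W (expHermField D) ∈ fibre F ℰp n K hnK.le V := by
    rw [hcfg]; exact ((mem_regFibrePr_iff F).mp hYmem).1
  -- HESS K-only from the (116) core and the slice inequality
  have heL : 100000000000000 * (F.L : ℝ) ^ 9 * e ≤ 1 := by
    rw [hFL]
    have : 100000000000000 * (L' : ℝ) ^ 9 * e ≤ 100000000000000 * (L' : ℝ) ^ 9 * e₆ := mul_le_mul_of_nonneg_left hhi (by positivity)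
    exact this.trans he₆L
  have hs0 : (0 : ℝ) ≤ 2 * sQ * ℓ⁻¹ := by positivity
  have hsL : 400000000000 * (F.L : ℝ) ^ 9 * (ℓ * (2 * sQ * ℓ⁻¹)) ≤ 1 := by
    rw [show ℓ * (2 * sQ * ℓ⁻¹) = 2 * sQ by field_simp, hFL]
    linarith
  have h116 := hessW_curl_div_of_mem_fibre_T3 F hnK.le V hW heL D hDh hs0 hDs hsL hfibD
  have hsl := hζrow D rfl
  set Kc : ℝ := ∑ p : Plaq (F.P K) 0, ‖((Complex.I • D ⟨p.src, p.μ⟩) + ((W ⟨p.src, p.μ⟩ : Matrix (Fin 2) (Fin 2) ℂ) * (Complex.I • D ⟨p.src.shift p.μ, p.ν⟩) * star (W ⟨p.src, p.μ⟩ : Matrix (Fin 2) (Fin 2) ℂ))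
            - (((W ⟨p.src, p.μ⟩ * W ⟨p.src.shift p.μ, p.ν⟩ * (W ⟨p.src.shift p.ν, p.μ⟩)⁻¹ : Matrix.specialUnitaryGroup (Fin 2) ℂ) : Matrix (Fin 2) (Fin 2) ℂ) * (Complex.I • D ⟨p.src.shift p.ν, p.μ⟩) * star ((W ⟨p.src, p.μ⟩ * W ⟨p.src.shift p.μ, p.ν⟩ * (W ⟨p.src.shift p.ν, p.μ⟩)⁻¹ : Matrix.specialUnitaryGroup (Fin 2) ℂ) : Matrix (Fin 2) (Fin 2) ℂ))
            - (((GaugeField.plaqHol W p : Matrix.specialUnitaryGroup (Fin 2) ℂ) : Matrix (Fin 2) (Fin 2) ℂ) * (Complex.I • D ⟨p.src, p.ν⟩) * star ((GaugeField.plaqHol W p : Matrix.specialUnitaryGroup (Fin 2) ℂ) : Matrix (Fin 2) (Fin 2) ℂ)))‖ ^ 2 with hKc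
  set Dv : ℝ := ∑ x : Site (F.P K) 0, ∑ j : Fin 2, ∑ k : Fin 2,
            ‖(divB (torusT (F.P K) 0) (fun κ z => unitsField (toUField W) ⟨z, κ⟩) (fun κ z => Complex.I • D ⟨z, κ⟩) x) j k‖ ^ 2 with hDv
  set Mm : ℝ := ∑ b : PBond (F.P K) 0, ‖D b‖ ^ 2 with hMm
  have hKc0 : 0 ≤ Kc := Finset.sum_nonneg fun _ _ => sq_nonneg _
  have hMm0 : 0 ≤ Mm := Finset.sum_nonneg fun _ _ => sq_nonneg _
  have hκH0 : (0 : ℝ) < 1 / (128 * (18 + 537600 * (F.L : ℝ) ^ 4)) := by positivity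
  have hζ4 : (0 : ℝ) < 1 + ζ / 4 := by linarith
  have hHESS : ((1 / (128 * (18 + 537600 * (L' : ℝ) ^ 4))) - δ₁ / 4) / (1 + ζ / 4) * (ℓ ^ 2)⁻¹ * Mm ≤ Kc := by
    rw [← hFL]
    -- `κ_H ℓ⁻² M ≤ Kc + ¼Dv ≤ (1 + ζ∕4) Kc + ¼δ₁ℓ⁻²M`
    have h1 : ((1 / (128 * (18 + 537600 * (F.L : ℝ) ^ 4))) - δ₁ / 4) * (ℓ ^ 2)⁻¹ * Mm ≤ (1 + ζ / 4) * Kc := by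
      have := h116
      nlinarith [hsl, this]
    rw [div_mul_eq_mul_div, div_mul_eq_mul_div, div_le_iff₀ hζ4]
    linarith [h1]
  exact ⟨D, hDh, hDs, hA, hfibD, hHESS, hsl⟩

end Summit.QuantumFields.YangMills.Theorems.Prop7LocMinOfPinnedChartSlice

end
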